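import Summits.Ventures.LatticeQCDFlow.TrivializingMaps.FlowAutocorrelationFloorAnyGroup
import Summits.Ventures.LatticeQCDFlow.TrivializingMaps.WilsonVarianceFloorAllCouplings

/-!
HONEST FRAMING: exact (Metropolis-corrected) sampling algorithms for lattice gauge theory; figures
of merit are autocorrelation/cost numbers at stated couplings and volumes; no continuum-physics
claim.

# FlowAutocorrelationAction — THE AUTOCORRELATION FLOOR FOR THE ACTION (MEAN PLAQUETTE) ITSELF, FULLY
# EXPLICIT: for the exact flow sampler of the Wilson measure with a model density `≤ C` over the Haar prior,
# `ρ_{S_W}(n) ≥ (1 − 4N²·#plaq²·C·e^{−mβ²/4}/m)ⁿ`, `m = e^{−β·2NK(1+4K)}·⌊L/2⌋^d·Var_Haar(Re tr ρ)` —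
# every compact gauge group with `Var_Haar(Re tr ρ) > 0`, every `β ≥ 0`, every `L ≥ 2` (lean-2 GEN-12, ours)

Venture-side (OURS).  Cell `lqcd-flow` (pub-lqcd), unit `pub-lqcd-lean-2-g12`, 2026-08-23.  The observable the
cell's scorers actually report is the (mean) plaquette, i.e. the Wilson action `S_W` up to normalisation.
`FlowAutocorrelationFloorAnyGroup.wilson_flow_autocorr_ge_pow_allCouplings` bounds the lag-`n` autocorrelation
of any bounded `g` below by `(1 − B²·acc/E_β[g²])ⁿ`; for the centred action `g = S_W − ⟨S_W⟩_β` one has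
`B = 2N·#plaq` (`0 ≤ S_W ≤ 2N·#plaq`, `WilsonPinching`) and `E_β[g²] = Var_β(S_W) ≥ m` by GEN-9's all-coupling
specific-heat floor (`WilsonVarianceFloorAllCouplings.wilson_variance_ge_allCouplings`), which makes the law
hypothesis-free in the target:

* `wilson_centredAction_bounded` — `|S_W − ⟨S_W⟩_β| ≤ 2N·#plaq`;
* `wilson_centredAction_sq_integral` — `E_β[(S_W − ⟨S_W⟩_β)²] = Var_β(S_W)`;
* **`wilson_flow_action_autocorr_ge_pow`** — unitary `ρ`, `d ≥ 2`, `L ≥ 2`, `β ≥ 0`, `Var_Haar(Re tr ρ) > 0`,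
  model density `0 < q ≤ C` with `∫ q dD[U] = 1`: for every `n`,
  `(max 0 (1 − (2N·#plaq)²·C·exp(−m·β²/4)/m))^{n+1} ≤ ρ_{S_W}(n+1)`, `m` as above — the normalised action
  autocorrelation `E_β[g·Kⁿ⁺¹g]/Var_β(S_W)` of the exact chain.

Reading (no numerics implied): the exponent `m·β²/4` is proportional to the volume while the prefactor
`(2N#plaq)²/m` is polynomial in it, so at every fixed `β > 0` the plaquette autocorrelation of an exact flow
sampler whose model stays within a factor `C` of the Haar prior is `≥ (1 − C·poly(V)·e^{−c(β)V})ⁿ`: it does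
not decorrelate the plaquette in fewer than `e^{c(β)V}/(C·poly(V))` steps.  NOT CLAIMED: `β`-uniformity of the
constants (`m` carries GEN-9's structural `e^{−βc}`); any statement for a specific trained model; the continuum.
Literature grade: KNOWN MECHANISM, NEW TYPING; nothing cited as a fact.
-/

noncomputable section

open MeasureTheory ProbabilityTheory Real Set Filter
open Literature.MathematicalPhysics.QuantumFieldTheory
open Literature.MathematicalPhysics.QuantumFieldTheory.Luscher2010
open Summit.Ventures.LatticeQCDFlow.Exactness
open Summit.Ventures.LatticeQCDFlow.Scaling

namespace Summit.Ventures.LatticeQCDFlow.TrivializingMaps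

section Wilson

variable {d L N : ℕ} [NeZero L] {G : Type*} [Group G] [TopologicalSpace G] [IsTopologicalGroup G]
  [CompactSpace G] [MeasurableSpace G] [BorelSpace G] [SecondCountableTopology G]
  (ρ : G →* Matrix (Fin N) (Fin N) ℂ)

/-- **The centred action is bounded by `2N·#plaq`**: `|S_W(U) − ⟨S_W⟩_β| ≤ 2N·#plaq` (both lie in
`[0, 2N·#plaq]`). [folklore] -/
theorem wilson_centredAction_bounded (hρ : Continuous ρ) (β : ℝ) (U : GaugeConfig d L G) :
    |wilsonAction ρ U - ∫ V, wilsonAction ρ V ∂(wilsonMeasure (d := d) (L := L) ρ β)| ≤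
      2 * N * Fintype.card (Plaquette d L) := by
  haveI := isProbabilityMeasure_wilsonMeasure (d := d) (L := L) ρ hρ β
  have h0 : ∀ V : GaugeConfig d L G, 0 ≤ wilsonAction ρ V := fun V => WilsonPinching.wilsonAction_nonneg ρ hρ V
  have h1 : ∀ V : GaugeConfig d L G, wilsonAction ρ V ≤ 2 * N * Fintype.card (Plaquette d L) :=
    fun V => WilsonPinching.wilsonAction_le ρ hρ V
  have hint : Integrable (wilsonAction (d := d) (L := L) ρ) (wilsonMeasure (d := d) (L := L) ρ β) :=
    Integrable.of_bound (continuous_wilsonAction_of_continuous ρ hρ).aestronglyMeasurable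
      (2 * N * Fintype.card (Plaquette d L)) (ae_of_all _ fun V => by
        rw [Real.norm_eq_abs]; exact WilsonPinching.abs_wilsonAction_le ρ hρ V)
  have hm0 : 0 ≤ ∫ V, wilsonAction ρ V ∂(wilsonMeasure (d := d) (L := L) ρ β) := integral_nonneg h0
  have hm1 : ∫ V, wilsonAction ρ V ∂(wilsonMeasure (d := d) (L := L) ρ β) ≤ 2 * N * Fintype.card (Plaquette d L) := by
    calc ∫ V, wilsonAction ρ V ∂(wilsonMeasure (d := d) (L := L) ρ β)
        ≤ ∫ _V, (2 * N * Fintype.card (Plaquette d L) : ℝ) ∂(wilsonMeasure (d := d) (L := L) ρ β) :=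
          integral_mono hint (integrable_const _) h1
      _ = 2 * N * Fintype.card (Plaquette d L) := by simp
  rw [abs_le]
  constructor <;> linarith [h0 U, h1 U]

/-- `E_β[(S_W − ⟨S_W⟩_β)²] = Var_β(S_W)`. [folklore] -/
theorem wilson_centredAction_sq_integral (hρ : Continuous ρ) (β : ℝ) :
    ∫ U, (wilsonAction ρ U - ∫ V, wilsonAction ρ V ∂(wilsonMeasure (d := d) (L := L) ρ β)) ^ 2
        ∂(wilsonMeasure (d := d) (L := L) ρ β) =
      variance (wilsonAction (d := d) (L := L) ρ) (wilsonMeasure (d := d) (L := L) ρ β) := by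
  rw [variance_eq_integral (continuous_wilsonAction_of_continuous ρ hρ).measurable.aemeasurable]

/-- **THE ACTION AUTOCORRELATION FLOOR, FULLY EXPLICIT** (unitary `ρ`, `d ≥ 2`, `L ≥ 2`, `β ≥ 0`,
`Var_Haar(Re tr ρ) > 0`, model density `0 < q ≤ C` over `D[U]` with `∫ q dD[U] = 1`): with
`m = e^{−β·2NK(1+4K)}·⌊L/2⌋^d·Var_Haar(Re tr ρ)`, `K = (d+1)d²`, and `g = S_W − ⟨S_W⟩_β`, for every `n`:
`(max 0 (1 − (2N·#plaq)²·C·exp(−m·β²/4)/m))^{n+1} ≤ E_β[g·Kⁿ⁺¹g]/Var_β(S_W)`. [ours] -/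
theorem wilson_flow_action_autocorr_ge_pow (hd : 2 ≤ d) (hL : 2 ≤ L) (hρ : Continuous ρ)
    (hρu : ∀ g, ρ g ∈ Matrix.unitaryGroup (Fin N) ℂ)
    (hv : 0 < variance (fun g => (ρ g).trace.re) (haarProbability G)) {β : ℝ} (hβ : 0 ≤ β)
    {q : GaugeConfig d L G → ℝ} (hqm : Measurable q) (hq0 : ∀ U, 0 < q U) {C : ℝ} (hqC : ∀ U, q U ≤ C)
    (hq1 : ∫ U, q U ∂(trivialMeasure G d L) = 1) (n : ℕ) :
    (max 0 (1 - (2 * N * Fintype.card (Plaquette d L)) ^ 2 *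
        (C * exp (-(Real.exp (-(β * (2 * N * ((d + 1) * d ^ 2 : ℕ) * (1 + 4 * ((d + 1) * d ^ 2 : ℕ))))) *
          ((L / 2) ^ d : ℕ) * variance (fun g => (ρ g).trace.re) (haarProbability G) * β ^ 2 / 4))) /
        (Real.exp (-(β * (2 * N * ((d + 1) * d ^ 2 : ℕ) * (1 + 4 * ((d + 1) * d ^ 2 : ℕ))))) *
          ((L / 2) ^ d : ℕ) * variance (fun g => (ρ g).trace.re) (haarProbability G)))) ^ (n + 1) ≤
      (∫ U, (wilsonAction ρ U - ∫ V, wilsonAction ρ V ∂(wilsonMeasure (d := d) (L := L) ρ β)) *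
          ((imhOp (trivialMeasure G d L)
            (fun U => exp (β * (-wilsonAction ρ U)) / mgf (fun U => -wilsonAction ρ U) (trivialMeasure G d L) β)
            q)^[n + 1] (fun U => wilsonAction ρ U -
              ∫ V, wilsonAction ρ V ∂(wilsonMeasure (d := d) (L := L) ρ β))) U
          ∂(wilsonMeasure (d := d) (L := L) ρ β)) /
        variance (wilsonAction (d := d) (L := L) ρ) (wilsonMeasure (d := d) (L := L) ρ β) := by
  set mS : ℝ := ∫ V, wilsonAction ρ V ∂(wilsonMeasure (d := d) (L := L) ρ β) with hmS
  set m : ℝ := Real.exp (-(β * (2 * N * ((d + 1) * d ^ 2 : ℕ) * (1 + 4 * ((d + 1) * d ^ 2 : ℕ))))) *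
    ((L / 2) ^ d : ℕ) * variance (fun g => (ρ g).trace.re) (haarProbability G) with hm
  -- the GEN-9 floor `m ≤ Var_β(S_W)`, and `m > 0`
  have hfloor : m ≤ variance (wilsonAction (d := d) (L := L) ρ) (wilsonMeasure (d := d) (L := L) ρ β) := by
    have h := wilson_variance_ge_allCouplings (d := d) (L := L) ρ hd hL hρ hρu β
    rwa [abs_of_nonneg hβ] at h
  have hLd : 0 < ((L / 2) ^ d : ℕ) := by
    have : 1 ≤ L / 2 := Nat.le_div_iff_mul_le (by norm_num) |>.2 (by omega)
    exact pow_pos (by omega) d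
  have hm0 : 0 < m := by
    rw [hm]
    refine mul_pos (mul_pos (exp_pos _) ?_) hv
    exact_mod_cast hLd
  have hVpos : 0 < variance (wilsonAction (d := d) (L := L) ρ) (wilsonMeasure (d := d) (L := L) ρ β) :=
    hm0.trans_le hfloor
  -- the general floor for the centred action
  have hgm : Measurable fun U : GaugeConfig d L G => wilsonAction ρ U - mS :=
    (continuous_wilsonAction_of_continuous ρ hρ).measurable.sub_const _
  have hgb : ∀ U : GaugeConfig d L G, |wilsonAction ρ U - mS| ≤ 2 * N * Fintype.card (Plaquette d L) :=
    fun U => wilson_centredAction_bounded ρ hρ β U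
  have hsq : ∫ U, (wilsonAction ρ U - mS) ^ 2 ∂(wilsonMeasure (d := d) (L := L) ρ β) =
      variance (wilsonAction (d := d) (L := L) ρ) (wilsonMeasure (d := d) (L := L) ρ β) :=
    wilson_centredAction_sq_integral ρ hρ β
  have hpos : 0 < ∫ U, (wilsonAction ρ U - mS) ^ 2 ∂(wilsonMeasure (d := d) (L := L) ρ β) := by
    rwa [hsq]
  have h := wilson_flow_autocorr_ge_pow_allCouplings (d := d) (L := L) ρ hd hL hρ hρu hβ hqm hq0 hqC hq1
    hgm hgb hpos n
  rw [hsq] at h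
  refine le_trans (pow_le_pow_left₀ (le_max_left _ _) (max_le_max le_rfl ?_) (n + 1)) h
  -- monotonicity in the denominator: `Var_β(S_W) ≥ m`
  have hnum : 0 ≤ (2 * (N : ℝ) * Fintype.card (Plaquette d L)) ^ 2 *
      (C * exp (-(Real.exp (-(β * (2 * N * ((d + 1) * d ^ 2 : ℕ) * (1 + 4 * ((d + 1) * d ^ 2 : ℕ))))) *
        ((L / 2) ^ d : ℕ) * variance (fun g => (ρ g).trace.re) (haarProbability G) * β ^ 2 / 4))) := by
    have hC : 0 ≤ C := (hq0 (Classical.arbitrary _)).le.trans (hqC _)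
    exact mul_nonneg (sq_nonneg _) (mul_nonneg hC (exp_pos _).le)
  exact sub_le_sub_left (div_le_div_of_nonneg_left hnum hm0 hfloor) 1

end Wilson

end Summit.Ventures.LatticeQCDFlow.TrivializingMaps

end
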